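import Literature.Probability.RandomPlanarGeometry.SLETransienceKappaFourEight
import Literature.Probability.RandomPlanarGeometry.SLETransienceLocal
import Literature.Probability.RandomPlanarGeometry.LoewnerAdaptedPlane
import Literature.Probability.Process.BlumenthalZeroOne
import HarnessLib

/-!
# Rohde–Schramm (2005), Lemma 7.3 for `4 < κ < 8`: a.s. sealing of the origin at every fixed time

Trunk T-STOCH. Proofs towards the named fact `RohdeSchramm2005_lem73` of `SLETransience.lean`
(S. Rohde, O. Schramm, *Basic properties of SLE*, Ann. of Math. 161 (2005), Lemma 7.3, p. 910:
"Suppose that `κ > 4`, `κ ≠ 8`, and let `t > 0`. Then a.s. there is some `ε > 0` such that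
`Kₜ ⊃ {z ∈ ℍ : |z| < ε}`."). This file proves the branch `κ ∈ (4, 8)` of the lemma **from the
existence of the SLE_κ trace alone** (`HasSLETrace κ`, Rohde–Schramm's Thm. 5.1, the named fact
`hasSLETrace_of_ne_eight`), completing the positive-probability statement of
`SLETransienceKappaFourEight.lean` by the two remaining steps of the printed proof (p. 910): "By
scale invariance, `p₀ := P[0 ∉ cl Hₜ]` is a constant not depending on `t`" and "by Blumenthal's
0-1 law, `p₀ ∈ {0, 1}`. Since `P[0 ∉ cl Hₜ] > 0` for some `t > 0`, this completes the proof in the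
case `κ ∈ (4, 8)`" — here with the event "`Kₜ ⊇ {z ∈ ℍ : |z| < ε}` for some `ε > 0`", which the
source identifies with `0 ∉ cl Hₜ` ("this is equivalent to the existence of some `t > 0` such
that `0 ∉ cl Hₜ`", p. 910).

* `Loewner.halfDiscSealed t` — the set of driving functions whose hull at time `t` contains a
  half-disc at `0`, in countable form (all points of a dense sequence of `ℍ` of norm `< 1/(n+1)`
  are swallowed by time `t`); for a continuous driving function this IS
  "`Kₜ ⊇ {z ∈ ℍ : |z| < ε}` for some `ε > 0`" (`Loewner.mem_halfDiscSealed_iff`, the domain `Hₜ`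
  being open), and it is an event of the path up to time `t` (`Loewner.measurableSet_mem_halfDiscSealed`,
  from `Loewner.measurableSet_lt_swallowingTime_of_im_pos`); for SLE_κ it is an `𝓕ₜ`-event
  (`measurableSet_halfDisc_sleHull_filtration`).
* **Scale invariance** (`measure_halfDisc_sleHull_eq`): `P[K_s ⊇ half-disc] = P[K_t ⊇ half-disc]`
  for all `s, t > 0` (Brownian scaling `identDistrib_sleDriving_rescale` read through the
  measurable regularisation `regPath`, and `Loewner.hull_scale_holds`: `K_t[cW(·/c²)] = c K_{t/c²}[W]`).
* **Zero-one** (`measure_halfDisc_sleHull_zero_or_one`): for `t > 0` that probability is `0` or `1`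
  (the events decrease, as `t = 1/(n+1) ↓ 0`, to an event of the germ σ-field; Blumenthal's 0-1
  law `IsPreBrownianReal.measure_zero_or_one_of_germ`, `BlumenthalZeroOne.lean`).
* **Positivity for `4 < κ < 8`** (`exists_measure_halfDisc_sleHull_ne_zero`): the proof of
  `tendsto_norm_sleTrace_atTop_of_cor35_of_four_lt_of_lt_eight` (access gap after `T_1` at a
  rational time, Markov property, Lemma 6.6 reflected, sealing through the hull cocycle) with the
  shifted trace supplied by `ae_exists_isGeneratedByCurve_shift_of_hasSLETrace` instead of Cor. 3.5.
* **Lemma 7.3 for `4 < κ < 8`** (`ae_exists_halfDisc_subset_sleHull`, from `HasSLETrace κ`;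
  `RohdeSchramm2005_lem73_of_lt_eight`, from the named fact `hasSLETrace_of_ne_eight`;
  `RohdeSchramm2005_lem73_of_cor35_of_lt_eight`, from `RohdeSchramm2005_cor35`).

What is NOT here: the branch `κ > 8` (printed proof: Thm. 6.4, Lemma 6.5, the Markov property at
`τ(z₀)`, Fubini and Cor. 5.3), and the discharge `RohdeSchramm2005_lem73_holds`, which besides
that branch needs Thm. 5.1 (`hasSLETrace_of_ne_eight`, not yet proved in the tree).

## Mathlib

We USE `TopologicalSpace.denseSeq` / `denseRange_denseSeq` (a dense sequence of `ℂ`),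
`DenseRange.exists_mem_open`, `ProbabilityTheory.IdentDistrib.measure_mem_eq`,
`MeasureTheory.tendsto_measure_iInter_atTop`, `Antitone.iInter_nat_add`, `NNReal.sqrt`.

## References

* S. Rohde, O. Schramm, *Basic properties of SLE*, Ann. of Math. 161 (2005) 883–924: Lemma 7.3
  and its proof (p. 910), Prop. 2.1 (scaling), Thm. 5.1, Lemma 6.6.
* D. Revuz, M. Yor, *Continuous Martingales and Brownian Motion* (1999), Ch. III Thm. (2.15)
  (Blumenthal's zero-one law).
-/

noncomputable section

open Set Filter Topology MeasureTheory ProbabilityTheory Metric Complex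
open UpperHalfPlane (upperHalfPlaneSet isOpen_upperHalfPlaneSet)
open scoped NNReal ENNReal

namespace Literature.Probability.RandomPlanarGeometry

namespace Loewner

/-! ### The sealing of the origin in countable form -/

/-- **The driving functions whose hull at time `t` seals the origin**, in countable form: `W` is
in `halfDiscSealed t` iff for some `n`, every point of the dense sequence `denseSeq ℂ` lying in
`ℍ` with norm `< 1/(n+1)` is swallowed by time `t` (`¬ t < T_z`). For continuous `W` this is
"`Kₜ ⊇ {z ∈ ℍ : |z| < ε}` for some `ε > 0`" (`mem_halfDiscSealed_iff`).
[cite: RohdeSchramm2005, Lemma 7.3] -/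
def halfDiscSealed (t : ℝ≥0) : Set (ℝ≥0 → ℝ) :=
  {W | ∃ n : ℕ, ∀ k : ℕ, TopologicalSpace.denseSeq ℂ k ∈ upperHalfPlaneSet →
    ‖TopologicalSpace.denseSeq ℂ k‖ < 1 / ((n : ℝ) + 1) →
      ¬ (t : WithTop ℝ≥0) < swallowingTime W (TopologicalSpace.denseSeq ℂ k)}

variable {W : ℝ≥0 → ℝ}

/-- **For a continuous driving function, `W ∈ halfDiscSealed t` iff `Kₜ ⊇ {z ∈ ℍ : |z| < ε}` for
some `ε > 0`.** (⇐) is immediate; (⇒): a point `z ∈ ℍ`, `|z| < 1/(n+1)`, off `Kₜ` lies in the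
open set `Hₜ ∩ {|w| < 1/(n+1)}` (`isOpen_domain`), which then contains a point of the dense
sequence, still flowing at time `t`. [cite: RohdeSchramm2005, Lemma 7.3] -/
theorem mem_halfDiscSealed_iff (hW : Continuous W) {t : ℝ≥0} :
    W ∈ halfDiscSealed t ↔
      ∃ ε : ℝ, 0 < ε ∧ {z ∈ upperHalfPlaneSet | ‖z‖ < ε} ⊆ hull W t := by
  constructor
  · rintro ⟨n, hn⟩
    refine ⟨1 / ((n : ℝ) + 1), by positivity, fun z hz ↦ ?_⟩
    obtain ⟨hzH, hzn⟩ := hz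
    by_contra hzK
    have hzdom : z ∈ domain W t := ⟨hzH, hzK⟩
    have hopen : IsOpen (domain W t ∩ {w : ℂ | ‖w‖ < 1 / ((n : ℝ) + 1)}) :=
      (isOpen_domain hW t).inter (isOpen_lt continuous_norm continuous_const)
    obtain ⟨k, hk⟩ := (TopologicalSpace.denseRange_denseSeq ℂ).exists_mem_open hopen
      ⟨z, hzdom, hzn⟩
    obtain ⟨hkdom, hkn⟩ := hk
    rw [mem_domain_iff] at hkdom
    exact hn k hkdom.1 hkn hkdom.2
  · rintro ⟨ε, hε, hsub⟩
    obtain ⟨n, hn⟩ := exists_nat_one_div_lt hε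
    refine ⟨n, fun k hkH hkn hlt ↦ ?_⟩
    have hmem : TopologicalSpace.denseSeq ℂ k ∈ hull W t := hsub ⟨hkH, hkn.trans hn⟩
    exact absurd hmem.2 (not_le.2 hlt)

/-- Rescaling the hull does not affect the sealing of the origin: for real `a > 0` and any
`K ⊆ ℂ`, `a · K` contains a half-disc at `0` iff `K` does. [folklore] -/
theorem exists_halfDisc_subset_image_mul_iff {a : ℝ} (ha : 0 < a) (K : Set ℂ) :
    (∃ ε : ℝ, 0 < ε ∧ {z ∈ upperHalfPlaneSet | ‖z‖ < ε} ⊆ (fun z ↦ (a : ℂ) * z) '' K) ↔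
      ∃ ε : ℝ, 0 < ε ∧ {z ∈ upperHalfPlaneSet | ‖z‖ < ε} ⊆ K := by
  have ha0 : (a : ℂ) ≠ 0 := ofReal_ne_zero.2 ha.ne'
  have hnorm : ∀ z : ℂ, ‖(a : ℂ) * z‖ = a * ‖z‖ := fun z ↦ by
    rw [norm_mul, Complex.norm_of_nonneg ha.le]
  constructor
  · rintro ⟨ε, hε, hsub⟩
    refine ⟨ε / a, div_pos hε ha, fun z hz ↦ ?_⟩
    obtain ⟨hzH, hzn⟩ := hz
    have hazH : (a : ℂ) * z ∈ upperHalfPlaneSet := by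
      change 0 < ((a : ℂ) * z).im
      rw [mul_im, ofReal_re, ofReal_im, zero_mul, add_zero]
      exact mul_pos ha hzH
    have hazn : ‖(a : ℂ) * z‖ < ε := by
      rw [hnorm, ← lt_div_iff₀' ha]
      exact hzn
    obtain ⟨z', hz'K, hz'⟩ := hsub ⟨hazH, hazn⟩
    have : z' = z := mul_left_cancel₀ ha0 hz'
    rw [← this]
    exact hz'K
  · rintro ⟨ε, hε, hsub⟩
    refine ⟨a * ε, mul_pos ha hε, fun z hz ↦ ?_⟩
    obtain ⟨hzH, hzn⟩ := hz
    refine ⟨(a : ℂ)⁻¹ * z, hsub ⟨?_, ?_⟩, ?_⟩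
    rotate_left 2
    · change (a : ℂ) * ((a : ℂ)⁻¹ * z) = z
      rw [← mul_assoc, mul_inv_cancel₀ ha0, one_mul]
    · change 0 < ((a : ℂ)⁻¹ * z).im
      rw [← ofReal_inv, mul_im, ofReal_re, ofReal_im, zero_mul, add_zero]
      exact mul_pos (inv_pos.2 ha) hzH
    · rw [← ofReal_inv, norm_mul, Complex.norm_of_nonneg (inv_pos.2 ha).le, inv_mul_lt_iff₀ ha]
      exact hzn

/-! ### Measurability from the path up to time `t` -/

section Measurable

variable {Ω : Type*} {mΩ : MeasurableSpace Ω} {X : Ω → ℝ≥0 → ℝ} {t : ℝ≥0}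

/-- **The sealing of the origin at time `t` is an event of the path up to time `t`** (continuous
paths whose values at times `≤ t` are measurable): a countable combination of the events
`{t < T_z}` (`measurableSet_lt_swallowingTime_of_im_pos`). [cite: RohdeSchramm2005, Lemma 7.3] -/
theorem measurableSet_mem_halfDiscSealed (hc : ∀ ω, Continuous (X ω))
    (hmeas : ∀ s, s ≤ t → Measurable fun ω ↦ X ω s) :
    MeasurableSet {ω | X ω ∈ halfDiscSealed t} := by
  have h : {ω | X ω ∈ halfDiscSealed t} = ⋃ n : ℕ, ⋂ k : ℕ,
      {ω | TopologicalSpace.denseSeq ℂ k ∈ upperHalfPlaneSet →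
        ‖TopologicalSpace.denseSeq ℂ k‖ < 1 / ((n : ℝ) + 1) →
          ¬ (t : WithTop ℝ≥0) < swallowingTime (X ω) (TopologicalSpace.denseSeq ℂ k)} := by
    ext ω
    simp only [halfDiscSealed, mem_setOf_eq, mem_iUnion, mem_iInter]
  rw [h]
  refine MeasurableSet.iUnion fun n ↦ MeasurableSet.iInter fun k ↦ ?_
  by_cases hk : TopologicalSpace.denseSeq ℂ k ∈ upperHalfPlaneSet ∧
      ‖TopologicalSpace.denseSeq ℂ k‖ < 1 / ((n : ℝ) + 1)
  · have hm := measurableSet_lt_swallowingTime_of_im_pos (t := t) hc hmeas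
      (x := TopologicalSpace.denseSeq ℂ k) hk.1
    have heq : {ω | TopologicalSpace.denseSeq ℂ k ∈ upperHalfPlaneSet →
        ‖TopologicalSpace.denseSeq ℂ k‖ < 1 / ((n : ℝ) + 1) →
          ¬ (t : WithTop ℝ≥0) < swallowingTime (X ω) (TopologicalSpace.denseSeq ℂ k)} =
        {ω | (t : WithTop ℝ≥0) < swallowingTime (X ω) (TopologicalSpace.denseSeq ℂ k)}ᶜ := by
      ext ω
      simp only [mem_setOf_eq, mem_compl_iff]
      exact ⟨fun h ↦ h hk.1 hk.2, fun h _ _ ↦ h⟩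
    rw [heq]
    exact hm.compl
  · have heq : {ω | TopologicalSpace.denseSeq ℂ k ∈ upperHalfPlaneSet →
        ‖TopologicalSpace.denseSeq ℂ k‖ < 1 / ((n : ℝ) + 1) →
          ¬ (t : WithTop ℝ≥0) < swallowingTime (X ω) (TopologicalSpace.denseSeq ℂ k)} = univ :=
      eq_univ_of_forall fun ω h1 h2 ↦ (hk ⟨h1, h2⟩).elim
    rw [heq]
    exact MeasurableSet.univ

/-- **Law transfer for the sealing of the origin**: for two families of continuous paths from
`0` which are identically distributed on the path space, the events "`Kₜ ⊇ {z ∈ ℍ : |z| < ε}` for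
some `ε > 0`" have the same probability (read through the measurable regularisation `regPath`).
[cite: RohdeSchramm2005, Prop. 2.1] -/
theorem measure_setOf_halfDisc_subset_hull_eq_of_identDistrib {P : Measure Ω}
    {W₁ W₂ : Ω → ℝ≥0 → ℝ} (hc₁ : ∀ ω, Continuous (W₁ ω)) (hc₂ : ∀ ω, Continuous (W₂ ω))
    (h0₁ : ∀ ω, W₁ ω 0 = 0) (h0₂ : ∀ ω, W₂ ω 0 = 0) (hid : IdentDistrib W₁ W₂ P P) (t : ℝ≥0) :
    P {ω | ∃ ε : ℝ, 0 < ε ∧ {z ∈ upperHalfPlaneSet | ‖z‖ < ε} ⊆ hull (W₁ ω) t} =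
      P {ω | ∃ ε : ℝ, 0 < ε ∧ {z ∈ upperHalfPlaneSet | ‖z‖ < ε} ⊆ hull (W₂ ω) t} := by
  have hS : MeasurableSet {w : ℝ≥0 → ℝ | regPath w ∈ halfDiscSealed t} :=
    measurableSet_mem_halfDiscSealed (X := regPath) (t := t) (fun w ↦ continuous_regPath w)
      fun s _ ↦ measurable_regPath s
  have h1 : {ω | ∃ ε : ℝ, 0 < ε ∧ {z ∈ upperHalfPlaneSet | ‖z‖ < ε} ⊆ hull (W₁ ω) t} =
      W₁ ⁻¹' {w : ℝ≥0 → ℝ | regPath w ∈ halfDiscSealed t} := by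
    ext ω
    change (∃ ε : ℝ, 0 < ε ∧ {z ∈ upperHalfPlaneSet | ‖z‖ < ε} ⊆ hull (W₁ ω) t) ↔
      regPath (W₁ ω) ∈ halfDiscSealed t
    rw [regPath_eq_self (hc₁ ω) (h0₁ ω), mem_halfDiscSealed_iff (hc₁ ω)]
  have h2 : {ω | ∃ ε : ℝ, 0 < ε ∧ {z ∈ upperHalfPlaneSet | ‖z‖ < ε} ⊆ hull (W₂ ω) t} =
      W₂ ⁻¹' {w : ℝ≥0 → ℝ | regPath w ∈ halfDiscSealed t} := by
    ext ω
    change (∃ ε : ℝ, 0 < ε ∧ {z ∈ upperHalfPlaneSet | ‖z‖ < ε} ⊆ hull (W₂ ω) t) ↔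
      regPath (W₂ ω) ∈ halfDiscSealed t
    rw [regPath_eq_self (hc₂ ω) (h0₂ ω), mem_halfDiscSealed_iff (hc₂ ω)]
  rw [h1, h2]
  exact hid.measure_mem_eq hS

end Measurable

end Loewner

/-! ### The SLE events: measurability, scale invariance, zero-one law -/

section SLE

open Loewner

variable (κ : ℝ≥0)

/-- **"`Kₜ ⊇ {z ∈ ℍ : |z| < ε}` for some `ε > 0`" is an `𝓕ₜ`-event for SLE_κ** (`𝓕` the natural
filtration of the Brownian motion): it is `{ω | √κ B(ω) ∈ halfDiscSealed t}`
(`mem_halfDiscSealed_iff`, every driving path being continuous), an event of the path up to time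
`t` (`measurableSet_mem_halfDiscSealed`). [cite: RohdeSchramm2005, Lemma 7.3] -/
theorem measurableSet_halfDisc_sleHull_filtration (t : ℝ≥0) :
    MeasurableSet[brownianFiltration t]
      {ω | ∃ ε : ℝ, 0 < ε ∧ {z ∈ upperHalfPlaneSet | ‖z‖ < ε} ⊆ sleHull κ ω t} := by
  have h : {ω | ∃ ε : ℝ, 0 < ε ∧ {z ∈ upperHalfPlaneSet | ‖z‖ < ε} ⊆ sleHull κ ω t} =
      {ω | sleDriving κ ω ∈ halfDiscSealed t} := by
    ext ω
    exact (mem_halfDiscSealed_iff (continuous_sleDriving κ ω)).symm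
  rw [h]
  exact measurableSet_mem_halfDiscSealed (mΩ := brownianFiltration t) (X := fun ω ↦ sleDriving κ ω)
    (t := t) (fun ω ↦ continuous_sleDriving κ ω) (fun _ hs ↦ measurable_sleDriving_of_le κ hs)

/-- The sealing event is measurable. [cite: RohdeSchramm2005, Lemma 7.3] -/
theorem measurableSet_halfDisc_sleHull (t : ℝ≥0) :
    MeasurableSet {ω | ∃ ε : ℝ, 0 < ε ∧ {z ∈ upperHalfPlaneSet | ‖z‖ < ε} ⊆ sleHull κ ω t} :=
  brownianFiltration.le t _ (measurableSet_halfDisc_sleHull_filtration κ t)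

/-- The sealing events increase with time (`Kₛ ⊆ Kₜ` for `s ≤ t`). [folklore] -/
theorem setOf_halfDisc_sleHull_mono {s t : ℝ≥0} (hst : s ≤ t) :
    {ω | ∃ ε : ℝ, 0 < ε ∧ {z ∈ upperHalfPlaneSet | ‖z‖ < ε} ⊆ sleHull κ ω s} ⊆
      {ω | ∃ ε : ℝ, 0 < ε ∧ {z ∈ upperHalfPlaneSet | ‖z‖ < ε} ⊆ sleHull κ ω t} :=
  fun ω ⟨ε, hε, hsub⟩ ↦ ⟨ε, hε, hsub.trans (hull_mono (sleDriving κ ω) hst)⟩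

/-- **Scaling of the sealing probability**: `P[K_t ⊇ half-disc] = P[K_{t/c²} ⊇ half-disc]` for
`c > 0` (equality in law `W ∼ c W(·/c²)`, `identDistrib_sleDriving_rescale`, transported by
`measure_setOf_halfDisc_subset_hull_eq_of_identDistrib`, and `K_t[cW(·/c²)] = c · K_{t/c²}[W]`,
`hull_scale_holds`). Rohde–Schramm (2005), proof of Lemma 7.3: "By scale invariance, `p₀` is a
constant not depending on `t`." [cite: RohdeSchramm2005, Lemma 7.3] -/
theorem measure_halfDisc_sleHull_eq_rescale {c : ℝ≥0} (hc : c ≠ 0) (t : ℝ≥0) :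
    Process.preWienerMeasure
        {ω | ∃ ε : ℝ, 0 < ε ∧ {z ∈ upperHalfPlaneSet | ‖z‖ < ε} ⊆ sleHull κ ω t} =
      Process.preWienerMeasure
        {ω | ∃ ε : ℝ, 0 < ε ∧ {z ∈ upperHalfPlaneSet | ‖z‖ < ε} ⊆ sleHull κ ω (t / c ^ 2)} := by
  have hc' : (0 : ℝ) < c := NNReal.coe_pos.2 (pos_iff_ne_zero.2 hc)
  have h := measure_setOf_halfDisc_subset_hull_eq_of_identDistrib (P := Process.preWienerMeasure)
    (fun ω ↦ continuous_sleDriving κ ω) (continuous_sleDriving_rescale κ c)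
    (fun ω ↦ sleDriving_zero κ ω) (fun ω ↦ by simp [sleDriving_zero])
    (identDistrib_sleDriving_rescale κ hc) t
  change Process.preWienerMeasure
      {ω | ∃ ε : ℝ, 0 < ε ∧ {z ∈ upperHalfPlaneSet | ‖z‖ < ε} ⊆ hull (sleDriving κ ω) t} =
    Process.preWienerMeasure
      {ω | ∃ ε : ℝ, 0 < ε ∧ {z ∈ upperHalfPlaneSet | ‖z‖ < ε} ⊆ hull (sleDriving κ ω) (t / c ^ 2)}
  rw [h]
  congr 1
  ext ω
  simp only [mem_setOf_eq]
  rw [hull_scale_holds (sleDriving κ ω) c hc t]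
  exact exists_halfDisc_subset_image_mul_iff hc' _

/-- **The sealing probability does not depend on `t > 0`.** [cite: RohdeSchramm2005, Lemma 7.3] -/
theorem measure_halfDisc_sleHull_eq {s t : ℝ≥0} (hs : 0 < s) (ht : 0 < t) :
    Process.preWienerMeasure
        {ω | ∃ ε : ℝ, 0 < ε ∧ {z ∈ upperHalfPlaneSet | ‖z‖ < ε} ⊆ sleHull κ ω s} =
      Process.preWienerMeasure
        {ω | ∃ ε : ℝ, 0 < ε ∧ {z ∈ upperHalfPlaneSet | ‖z‖ < ε} ⊆ sleHull κ ω t} := by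
  -- `c = √(s/t)`: `s / c² = t`
  set c : ℝ≥0 := NNReal.sqrt (s / t) with hc
  have hc0 : c ≠ 0 := by
    rw [hc]
    exact (NNReal.sqrt_pos.2 (div_pos hs ht)).ne'
  have hct : s / c ^ 2 = t := by
    rw [hc, NNReal.sq_sqrt, div_div_cancel₀ hs.ne']
  rw [measure_halfDisc_sleHull_eq_rescale κ hc0 s, hct]

/-- **Zero-one law for the sealing of the origin** (`t > 0`): `P[K_t ⊇ half-disc] ∈ {0, 1}`. The
events decrease as `t = 1/(n+1) ↓ 0` to an event which, for every `s > 0`, is an `𝓕_s`-event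
(`measurableSet_halfDisc_sleHull_filtration`), hence has probability `0` or `1` by Blumenthal's
zero-one law (`IsPreBrownianReal.measure_zero_or_one_of_germ`); by scale invariance all these
events have the same probability, which is then also that of the limit. Rohde–Schramm (2005),
proof of Lemma 7.3 (p. 910): "By Blumenthal's 0-1 law, `p₀ ∈ {0, 1}`."
[cite: RohdeSchramm2005, Lemma 7.3] -/
theorem measure_halfDisc_sleHull_zero_or_one {t : ℝ≥0} (ht : 0 < t) :
    Process.preWienerMeasure
        {ω | ∃ ε : ℝ, 0 < ε ∧ {z ∈ upperHalfPlaneSet | ‖z‖ < ε} ⊆ sleHull κ ω t} = 0 ∨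
      Process.preWienerMeasure
        {ω | ∃ ε : ℝ, 0 < ε ∧ {z ∈ upperHalfPlaneSet | ‖z‖ < ε} ⊆ sleHull κ ω t} = 1 := by
  haveI := isProbabilityMeasure_preWienerMeasure'
  set μ : Measure (ℝ≥0 → ℝ) := Process.preWienerMeasure with hμ
  -- the events at times `1/(n+1)`
  set tn : ℕ → ℝ≥0 := fun n ↦ 1 / ((n : ℝ≥0) + 1) with htn
  have htn_pos : ∀ n, 0 < tn n := fun n ↦ by rw [htn]; positivity
  have htn_anti : Antitone tn := by
    intro m n hmn
    simp only [htn]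
    exact one_div_le_one_div_of_le (by positivity) (by exact_mod_cast Nat.add_le_add_right hmn 1)
  set A : ℕ → Set (ℝ≥0 → ℝ) := fun n ↦
    {ω | ∃ ε : ℝ, 0 < ε ∧ {z ∈ upperHalfPlaneSet | ‖z‖ < ε} ⊆ sleHull κ ω (tn n)} with hA
  have hA_anti : Antitone A := fun m n hmn ↦ setOf_halfDisc_sleHull_mono κ (htn_anti hmn)
  have hA_filt : ∀ n, MeasurableSet[brownianFiltration (tn n)] (A n) := fun n ↦
    measurableSet_halfDisc_sleHull_filtration κ (tn n)
  have hA_meas : ∀ n, MeasurableSet (A n) := fun n ↦ brownianFiltration.le _ _ (hA_filt n)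
  have hA_eq : ∀ n, μ (A n) = μ (A 0) := fun n ↦
    measure_halfDisc_sleHull_eq κ (htn_pos n) (htn_pos 0)
  -- the limit event and its probability
  set E : Set (ℝ≥0 → ℝ) := ⋂ n, A n with hE
  have hE_meas_filt : ∀ s : ℝ≥0, 0 < s → MeasurableSet[brownianFiltration s] E := by
    intro s hs
    obtain ⟨m, hm⟩ := exists_nat_one_div_lt (NNReal.coe_pos.2 hs)
    have hms : tn m ≤ s := by
      rw [← NNReal.coe_le_coe, htn]
      push_cast
      exact hm.le
    rw [hE, ← hA_anti.iInter_nat_add m]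
    refine MeasurableSet.iInter fun n ↦ ?_
    have hle : tn (n + m) ≤ s := (htn_anti (Nat.le_add_left m n)).trans hms
    exact brownianFiltration.mono hle _ (hA_filt (n + m))
  have hE01 : μ E = 0 ∨ μ E = 1 := by
    refine isPreBrownianReal_brownian.measure_zero_or_one_of_germ Process.measurable_brownian
      Process.continuous_brownian (fun ω ↦ by rw [Process.brownian_zero]; rfl) fun s hs ↦ ⟨E, ?_, ?_⟩
    · rw [← brownianFiltration_eq_comap s]
      exact hE_meas_filt s hs
    · exact EventuallyEq.rfl
  have hE_eq : μ E = μ (A 0) := by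
    have h := tendsto_measure_iInter_atTop (μ := μ) (fun n ↦ (hA_meas n).nullMeasurableSet) hA_anti
      ⟨0, measure_ne_top μ _⟩
    have hconst : (⇑μ ∘ A) = fun _ ↦ μ (A 0) := funext hA_eq
    rw [hconst] at h
    exact (tendsto_nhds_unique tendsto_const_nhds h).symm
  -- transfer to time `t`
  have ht_eq : μ {ω | ∃ ε : ℝ, 0 < ε ∧ {z ∈ upperHalfPlaneSet | ‖z‖ < ε} ⊆ sleHull κ ω t} =
      μ (A 0) := measure_halfDisc_sleHull_eq κ ht (htn_pos 0)
  rw [ht_eq, ← hE_eq]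
  exact hE01

/-- From probability one to almost surely. [folklore] -/
theorem ae_exists_halfDisc_subset_sleHull_of_measure_eq_one {t : ℝ≥0}
    (h : Process.preWienerMeasure
      {ω | ∃ ε : ℝ, 0 < ε ∧ {z ∈ upperHalfPlaneSet | ‖z‖ < ε} ⊆ sleHull κ ω t} = 1) :
    ∀ᵐ ω ∂Process.preWienerMeasure,
      ∃ ε : ℝ, 0 < ε ∧ {z ∈ upperHalfPlaneSet | ‖z‖ < ε} ⊆ sleHull κ ω t := by
  haveI := isProbabilityMeasure_preWienerMeasure'
  rw [ae_iff]
  change Process.preWienerMeasure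
    {ω | ∃ ε : ℝ, 0 < ε ∧ {z ∈ upperHalfPlaneSet | ‖z‖ < ε} ⊆ sleHull κ ω t}ᶜ = 0
  rw [prob_compl_eq_zero_iff (measurableSet_halfDisc_sleHull κ t)]
  exact h

/-- **A sealed half-disc with positive probability at one positive time is sealed almost surely
at every positive time** (scale invariance and the zero-one law). This is the conclusion of the
printed proof of Lemma 7.3: "Since `P[0 ∉ cl Hₜ] > 0` for some `t > 0`, this completes the proof"
(p. 910). [cite: RohdeSchramm2005, Lemma 7.3] -/
theorem ae_exists_halfDisc_subset_sleHull_of_measure_ne_zero {t₁ : ℝ≥0} (ht₁ : 0 < t₁)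
    (hne : Process.preWienerMeasure
      {ω | ∃ ε : ℝ, 0 < ε ∧ {z ∈ upperHalfPlaneSet | ‖z‖ < ε} ⊆ sleHull κ ω t₁} ≠ 0)
    {t : ℝ≥0} (ht : 0 < t) :
    ∀ᵐ ω ∂Process.preWienerMeasure,
      ∃ ε : ℝ, 0 < ε ∧ {z ∈ upperHalfPlaneSet | ‖z‖ < ε} ⊆ sleHull κ ω t := by
  refine ae_exists_halfDisc_subset_sleHull_of_measure_eq_one κ ?_
  rcases measure_halfDisc_sleHull_zero_or_one κ ht with h0 | h1
  · rw [measure_halfDisc_sleHull_eq κ ht ht₁] at h0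
    exact absurd h0 hne
  · exact h1

/-- A sealed half-disc with positive probability forces the time to be positive (`K₀ = ∅`: every
`z ∈ ℍ` flows for a positive time, `swallowingTime_pos_holds`). [folklore] -/
theorem pos_of_measure_halfDisc_sleHull_ne_zero {t : ℝ≥0}
    (hne : Process.preWienerMeasure
      {ω | ∃ ε : ℝ, 0 < ε ∧ {z ∈ upperHalfPlaneSet | ‖z‖ < ε} ⊆ sleHull κ ω t} ≠ 0) :
    0 < t := by
  rcases (zero_le : (0 : ℝ≥0) ≤ t).eq_or_lt with rfl | ht
  · exfalso
    refine hne (measure_eq_zero_iff_ae_notMem.2 (Eventually.of_forall fun ω hω ↦ ?_))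
    obtain ⟨ε, hε, hsub⟩ := hω
    have hzH : ((ε / 2 : ℝ) : ℂ) * I ∈ upperHalfPlaneSet := by
      change 0 < (((ε / 2 : ℝ) : ℂ) * I).im
      rw [mul_im, ofReal_re, ofReal_im, I_re, I_im, mul_zero, mul_one, add_zero]
      positivity
    have hzn : ‖((ε / 2 : ℝ) : ℂ) * I‖ < ε := by
      rw [norm_mul, norm_I, mul_one, norm_real, Real.norm_eq_abs, abs_of_pos (half_pos hε)]
      linarith
    have hmem := hsub ⟨hzH, hzn⟩
    have hle : swallowingTime (sleDriving κ ω) (((ε / 2 : ℝ) : ℂ) * I) ≤ (0 : ℝ≥0) := hmem.2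
    have hpos : 0 < swallowingTime (sleDriving κ ω) (((ε / 2 : ℝ) : ℂ) * I) := by
      refine swallowingTime_pos_holds (continuous_sleDriving κ ω) fun h ↦ ?_
      have him : 0 < (((ε / 2 : ℝ) : ℂ) * I).im := hzH
      rw [h, ofReal_im] at him
      exact lt_irrefl _ him
    exact (lt_irrefl _) (hpos.trans_le (by exact_mod_cast hle))
  · exact ht

/-! ### Positivity for `4 < κ < 8` and Lemma 7.3 in that range -/

variable {κ}

/-- **For `4 < κ < 8`, if SLE_κ is generated by a curve, some `K_t` seals a half-disc at `0` with
positive probability.** The proof of `tendsto_norm_sleTrace_atTop_of_cor35_of_four_lt_of_lt_eight`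
(`SLETransienceKappaFourEight.lean`) up to its last step: a past event `A ∈ 𝓕_t` (access gap at
a rational time `t` after `T_1`, positive probability, `exists_measure_accessGapTest_ne_zero`), an
independent future event (the increments swallow `[a - 1, b/2] ⊃ [a, b]` at once by time `s₀`,
positive probability by Lemma 6.6 reflected, `exists_measure_inter_shift_swallowAtOnceNeg_pos`),
and on both `K_{t+s₀} ⊇ {z ∈ ℍ : |z| < ε}` (`IsGeneratedByCurve.exists_halfDisc_subset_hull_add`),
the chain of the increments being generated by a curve a.s.
(`ae_exists_isGeneratedByCurve_shift_of_hasSLETrace`, from `HasSLETrace κ` alone). Rohde–Schramm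
(2005), proof of Lemma 7.3 (p. 910). [cite: RohdeSchramm2005, Lemma 7.3] -/
theorem exists_measure_halfDisc_sleHull_ne_zero (h0 : HasSLETrace κ) (hκ4 : 4 < κ) (hκ8 : κ < 8) :
    ∃ t : ℝ≥0, Process.preWienerMeasure
      {ω | ∃ ε : ℝ, 0 < ε ∧ {z ∈ upperHalfPlaneSet | ‖z‖ < ε} ⊆ sleHull κ ω t} ≠ 0 := by
  -- Step 1: a past event of positive probability
  obtain ⟨q, N, j, hApos⟩ := exists_measure_accessGapTest_ne_zero h0 hκ4
  set t : ℝ≥0 := ratTime q with ht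
  set a : ℝ := -(N : ℝ) with hadef
  set b : ℝ := -(1 / ((j : ℝ) + 1)) with hbdef
  have hb0 : b < 0 := by rw [hbdef]; exact neg_neg_of_pos (by positivity)
  have hA : MeasurableSet[brownianFiltration t] {ω | Loewner.accessGapTest (sleDriving κ ω) t a b} :=
    measurableSet_accessGapTest_sle κ t a b
  -- Step 2: the independent future event
  set a' : ℝ := a - 1 with ha'
  set b' : ℝ := b / 2 with hb'
  have haa' : a' < a := by rw [ha']; linarith
  have hbb' : b < b' := by rw [hb']; linarith
  have hb'0 : b' < 0 := by rw [hb']; linarith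
  have hab' : a' < b' := by
    have h1 : (1 : ℝ) / ((j : ℝ) + 1) ≤ 1 := by
      rw [div_le_one (by positivity)]; linarith [j.cast_nonneg (α := ℝ)]
    have h2 : (0 : ℝ) ≤ N := N.cast_nonneg
    rw [ha', hb', hadef, hbdef]
    linarith
  obtain ⟨s₀, hne⟩ := exists_measure_inter_shift_swallowAtOnceNeg_pos hκ4 hκ8 t hA hApos hab' hb'0
  refine ⟨t + s₀, fun hzero ↦ hne ?_⟩
  refine measure_mono_null_ae ?_ hzero
  -- Step 3: on both events (and the a.s. generation events) the half-disc is sealed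
  filter_upwards [ae_isGeneratedByCurve_sleTrace h0,
    ae_exists_isGeneratedByCurve_shift_of_hasSLETrace h0 t] with ω hγ hβ hω
  obtain ⟨hωA, hωF⟩ := hω
  obtain ⟨β, hβ⟩ := hβ
  have hW := continuous_sleDriving κ ω
  set V : ℝ≥0 → ℝ := fun u ↦ sleDriving κ ω (t + u) - sleDriving κ ω t with hV
  have hVc : Continuous V :=
    ((continuous_sleDriving κ ω).comp (continuous_const.add continuous_id)).sub continuous_const
  have hV0 : V 0 = 0 := by simp [hV]
  -- the zeros of `f̄_t`
  have hzeros := (hγ.accessGapTest_iff hW t a b).1 hωA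
  -- the future event: `T_{a'} = T_{b'} = T ≤ s₀` for the chain of `V`
  have hωF' : V ∈ swallowAtOnceNegEvent a' b' s₀ := hωF
  rw [mem_swallowAtOnceNegEvent_iff hVc hV0] at hωF'
  obtain ⟨hTeq, hTle⟩ := hωF'
  have hTfin : Loewner.swallowingTime V b' ≠ ⊤ := ne_top_of_le_ne_top WithTop.coe_ne_top hTle
  obtain ⟨T, hT⟩ := WithTop.ne_top_iff_exists.1 hTfin
  have hTb : Loewner.swallowingTime V b' = T := hT.symm
  have hTa : Loewner.swallowingTime V a' = T := hTeq.trans hTb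
  have hTs : T ≤ s₀ := by rw [← WithTop.coe_le_coe, hT]; exact hTle
  have hseal : ∀ w : ℝ, a' < w → w < b' → (w : ℂ) ∉ closure (Loewner.domain V s₀) :=
    fun w haw hwb ↦ hβ.notMem_closure_domain_of_swallowingTime_eq hVc hV0 haw hwb hb'0 hTa hTb hTs
  exact hγ.exists_halfDisc_subset_hull_add hW hzeros haa' hbb' hseal

/-- **Rohde–Schramm (2005), Lemma 7.3 for `4 < κ < 8`, from the existence of the trace.** If
SLE_κ is a.s. generated by a curve (`HasSLETrace κ`, Thm. 5.1) and `4 < κ < 8`, then for every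
`t > 0`, almost surely `Kₜ ⊇ {z ∈ ℍ : |z| < ε}` for some `ε > 0`. Printed proof (p. 910): a
sealed half-disc with positive probability at some fixed time
(`exists_measure_halfDisc_sleHull_ne_zero`: Thm. 5.1, Lemma 6.6, Markov property), scale
invariance and Blumenthal's zero-one law (`ae_exists_halfDisc_subset_sleHull_of_measure_ne_zero`).
[cite: RohdeSchramm2005, Lemma 7.3] -/
theorem ae_exists_halfDisc_subset_sleHull (h0 : HasSLETrace κ) (hκ4 : 4 < κ) (hκ8 : κ < 8)
    {t : ℝ≥0} (ht : 0 < t) :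
    ∀ᵐ ω ∂Process.preWienerMeasure,
      ∃ ε : ℝ, 0 < ε ∧ {z ∈ upperHalfPlaneSet | ‖z‖ < ε} ⊆ sleHull κ ω t := by
  obtain ⟨t₁, hne⟩ := exists_measure_halfDisc_sleHull_ne_zero h0 hκ4 hκ8
  exact ae_exists_halfDisc_subset_sleHull_of_measure_ne_zero κ
    (pos_of_measure_halfDisc_sleHull_ne_zero κ hne) hne ht

/-- **Lemma 7.3 for `4 < κ < 8` from the named fact `hasSLETrace_of_ne_eight`** (Rohde–Schramm's
Thm. 5.1, hypothesis `h51`): the case `κ ∈ (4, 8)` of `RohdeSchramm2005_lem73`.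
[cite: RohdeSchramm2005, Lemma 7.3] -/
theorem RohdeSchramm2005_lem73_of_lt_eight (h51 : hasSLETrace_of_ne_eight) {κ : ℝ≥0}
    (hκ4 : 4 < κ) (hκ8 : κ < 8) {t : ℝ≥0} (ht : 0 < t) :
    ∀ᵐ ω ∂Process.preWienerMeasure,
      ∃ ε : ℝ, 0 < ε ∧ {z ∈ upperHalfPlaneSet | ‖z‖ < ε} ⊆ sleHull κ ω t :=
  ae_exists_halfDisc_subset_sleHull (h51 (ne_of_lt hκ8)) hκ4 hκ8 ht

/-- **Lemma 7.3 for `4 < κ < 8` from Rohde–Schramm's derivative estimate Cor. 3.5**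
(`RohdeSchramm2005_cor35`, through which SLE_κ, `κ ≠ 8`, is generated by a curve:
`hasSLETrace_of_ne_eight_of_cor35`). [cite: RohdeSchramm2005, Lemma 7.3] -/
theorem RohdeSchramm2005_lem73_of_cor35_of_lt_eight
    (h35 : RohdeSchramm2005_cor35 Process.preWienerMeasure) {κ : ℝ≥0}
    (hκ4 : 4 < κ) (hκ8 : κ < 8) {t : ℝ≥0} (ht : 0 < t) :
    ∀ᵐ ω ∂Process.preWienerMeasure,
      ∃ ε : ℝ, 0 < ε ∧ {z ∈ upperHalfPlaneSet | ‖z‖ < ε} ⊆ sleHull κ ω t :=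
  ae_exists_halfDisc_subset_sleHull (hasSLETrace_of_ne_eight_of_cor35 h35 (ne_of_lt hκ8)) hκ4 hκ8 ht

/-- **`RohdeSchramm2005_lem73` from Thm. 5.1 and its `κ > 8` branch.** The named fact follows
from `hasSLETrace_of_ne_eight` (hypothesis `h51`, giving the branch `4 < κ < 8` by
`RohdeSchramm2005_lem73_of_lt_eight`) together with the conclusion of the lemma for `κ > 8`
(hypothesis `h9`; printed proof: Thm. 6.4, Lemma 6.5, the Markov property at `τ(z₀)`, Fubini and
Cor. 5.3, not formalised here). By `ae_exists_halfDisc_subset_sleHull_of_measure_ne_zero` it is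
enough to know `h9` with positive probability at one positive time for each `κ > 8`.
[cite: RohdeSchramm2005, Lemma 7.3] -/
theorem RohdeSchramm2005_lem73_of_thm51_of_gt_eight (h51 : hasSLETrace_of_ne_eight)
    (h9 : ∀ {κ : ℝ≥0}, 8 < κ → ∃ t : ℝ≥0, Process.preWienerMeasure
      {ω | ∃ ε : ℝ, 0 < ε ∧ {z ∈ upperHalfPlaneSet | ‖z‖ < ε} ⊆ sleHull κ ω t} ≠ 0) :
    RohdeSchramm2005_lem73 := by
  intro κ hκ4 hκ8 t ht
  rcases lt_or_gt_of_ne hκ8 with hlt | hgt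
  · exact RohdeSchramm2005_lem73_of_lt_eight h51 hκ4 hlt ht
  · obtain ⟨t₁, hne⟩ := h9 hgt
    exact ae_exists_halfDisc_subset_sleHull_of_measure_ne_zero κ
      (pos_of_measure_halfDisc_sleHull_ne_zero κ hne) hne ht

end SLE

end Literature.Probability.RandomPlanarGeometry
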